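import Summits.BirchSwinnertonDyer.BirchSwinnertonDyer.Theorems.Rank1ResidualX9CMPartner
import Literature.NumberTheory.EllipticCurves.Rank1Residual.X9TrivialPartner
import Literature.NumberTheory.EllipticCurves.Rank1Residual.X9MuInvariant
import HarnessLib

/-!
# BSD rank-≤1 residual cell, class X9: the typed missing input INHABITED, pair by pair, on the
# trivial-partner locus (route U2) — pointwise `IntegralMainConjectureOnClassX9` for every image type

HONEST FRAMING (cell `b2b-bsdres-*`, verbatim): the goal of the cell is to DELETE the
COMBINATION-SHAPED residual classes for ALL analytic-rank ≤ 1 curves over ℚ — "full BSD formula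
for every rank ≤ 1 curve in class C" assembled STRICTLY from published theorems — so that the
rank-≤1 remainder becomes exactly the CONSTRUCTION-SHAPED classes, which are TYPED (missing-input
Props), NOT attempted; this is not "finishing BSD".

Theorems only (helper file of the statement item `SelmerRankSmallImage`,
stmt-BirchSwinnertonDyer-14418, like `Rank1ResidualX9Defs.lean`, `Rank1ResidualX9RankZero.lean`,
`Rank1ResidualX9CMPartner.lean`). X9 prover gen 1 TYPED the class (target `BSDpOnClassX9`, missing
input `IntegralMainConjectureOnClassX9` = the integral cyclotomic main conjecture at a class-X9
prime, where hypothesis (im) of every printed integral main conjecture fails); gen 4 met the typed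
input pointwise on the CM-partner locus (route U1′, split-dihedral pairs only). Gen 5 (this file)
records the second transfer route, U2 of `Literature/…/Rank1Residual/X9TrivialPartner.lean`, which
needs NO complex multiplication and therefore reaches EVERY image type of X9 — in particular the
projective-`𝔖₄` pairs such as the census pair `2268b1 @ 5` (congruent mod `5` to `324b1`, a rank-0
curve of conductor `324 < 5000` with trivial `5`-primary arithmetic): if the X9 pair `(E, p)` has
a congruent partner `A` (certificate C1: `Γ_ℚ`-equivariant `A[p] ≃ E[p]`) with good ordinary,
non-anomalous reduction at `p`, `p ∤ ∏ c_ℓ(A)`, `ord_p(L(A,1)/Ω_A) = 0` and `#Sel_{p^∞}(A/ℚ) = 1`,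
then Greenberg's LNM 1716 Thm. 4.1 + integrality (Greenberg–Vatsal 2000 Prop. 3.7) make Mazur's
main conjecture for `(A, p)` hold trivially (`Λ = Λ`, `μ = 0`), and Greenberg–Vatsal 2000
Thm. (1.4) with Kato's (1.2) transports it along `A[p] ≅ E[p]` to `(E, p)`:

* `integralMainConjectureOnClassX9_at_of_trivialPartner` — the BODY of
  `IntegralMainConjectureOnClassX9` at `(W, p)` (level `N_E`, `Ω⁺_f`-normalisation
  `ι g = L_p(f, α)`), reached from the Néron normalisation of the Literature theorem
  `Rank1Residual.X9.mazurMainConjecture_of_trivialPartner` through the period unit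
  `realPeriodRat_eq_unit_mul_plusPeriod` (as in gen 4's `…_of_cmPartner`);
* `bsdp_of_classX9_of_trivialPartner` — Miller's `BSD(E,p)` in analytic rank `≤ 1` over THIS
  file's `ClassX9` (rank 0: partner certificates + C1; rank 1: + the Schneider certificate C3), a
  re-export of `Rank1Residual.X9.bsdp_of_trivialPartner_of_analyticRank_le_one`;
* `bsdp_of_classX9_of_trivialPartner_of_conductor_lt` — the same with the partner's Selmer
  certificate discharged by Miller / Creutz–Miller (`bsdp_of_irreducible_of_conductor_lt`) when
  `N_A < 5000` and `r_an(A) = 0`, and C1 as the finite Kraus–Oesterlé congruence list: every binder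
  is then a PUBLISHED named fact or a FINITE exact certificate.
* `integralMainConjectureOnClassX9_at_of_mu_eq_zero` and `bsdpOnClassX9_at_iff_mu_eq_zero` — from
  `Rank1Residual/X9MuInvariant.lean` (same gen): the typed input at `(W, p)` from Greenberg's
  `μ = 0` for `(E, p)` (OPEN per-pair binder) plus one unit coefficient of `L_p(E)`; and, in analytic
  rank `0`, the typed target at `(W, p)` (Miller's `BSDp W p`) is EQUIVALENT to that `μ = 0` —
  the residue of class X9 is Greenberg's Conj. 1.11 instance, pair by pair.
* `bsdp_of_classX9_of_bsdpPartner_of_conductor_lt` — route U2′ (appended to `X9MuInvariant.lean`):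
  a rank-0 partner of conductor `< 5000` with one unit coefficient of `𝓛_MSD(A)` (no triviality
  needed) transfers `BSD(A,p)` (Creutz–Miller) to the X9 pair.

Nothing here claims the class closed: `BSDpOnClassX9` and `IntegralMainConjectureOnClassX9` stay
OPEN as ∀-statements (a partner is a per-pair datum; prover's census of partners inside Cremona's
tables: `HOME/b2b-bsdres-x9/X9-U2-G5.md`), and no pair counts as settled before its certificates are
lane-certified (referee R17.3 (3) / R19.2).
-/

set_option linter.dupNamespace false

noncomputable section

open scoped Classical MatrixGroups ModularForm

open CongruenceSubgroup WeierstrassCurve Literature.NumberTheory.EllipticCurves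
  Literature.NumberTheory.EllipticCurves.ModularForms
  Literature.NumberTheory.EllipticCurves.Rank1Residual

namespace Summit.BirchSwinnertonDyer.BirchSwinnertonDyer.Rank1Residual

/-- **The typed missing input of class X9, MET at a pair with a certified trivial partner (route
U2).** For `W` globally minimal with `ClassX9 W p`, a globally minimal `A` good ordinary at `p` with
the certificates `hna` (`p ∤ #Ã(𝔽_p)`), `htam` (`p ∤ ∏ c_ℓ(A)`), `hL` (`L(A,1)/Ω_A` a non-zero rational
of valuation `0`), `hSel` (`#Sel_{p^∞}(A/ℚ) = 1`) and C1 (`hC1`: `Γ_ℚ`-equivariant `A[p] ≃ E[p]`): for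
the cyclotomic data `(κ, γ)`, the newform `f` of `E` at level `N_E` and every dual datum `D`,
`X(E/ℚ_∞)` is `Λ`-torsion and `char_Λ X = (g)` with `ι g = L_p(f, α)` ON THE NOSE — the body of
`IntegralMainConjectureOnClassX9` at `(W, p)`, for every image type of `ρ̄_{E,p}`. PUBLISHED inputs:
Burungale–Castella–Skinner 2025 Thm. 1.1.2 (a) (`hBCS`, torsion + principal characteristic ideal for
`A`), Greenberg LNM 1716 Thm. 4.1 (`hGr`), the period unit (`h5`, Greenberg–Vatsal §3 Remark 3.4 with
the Manin constant; used for `A` inside the Literature theorem and for `E` here to rescale the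
generator), Greenberg–Vatsal 2000 Thm. (1.4) + (1.2) (`hGV`).
[cite: GreenbergVatsal2000, Thm. (1.4) (arXiv p. 5) and §3 Remark (3.4)] [cite: GreenbergLNM1716, Thm. 4.1 (p. 102)] -/
theorem integralMainConjectureOnClassX9_at_of_trivialPartner
    (hBCS : burungale_castella_skinner_charIdeal_eq_padicLFunction)
    (hGr : greenberg_charValue_rankZero) (h5 : realPeriodRat_eq_unit_mul_plusPeriod)
    (hGV : GreenbergVatsal2000.thm14_mainConjecture_transfer_of_torsionIso)
    (W A : WeierstrassCurve ℚ) [W.IsElliptic] [W.IsGloballyMinimal] [A.IsElliptic]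
    [A.IsGloballyMinimal] (p : ℕ) [Fact p.Prime] (hX9 : ClassX9 W p)
    (hgoodA : A.HasGoodReductionAtPrime p) (hordA : ¬ (p : ℤ) ∣ A.frobeniusTrace p)
    (hna : ¬ p ∣ A.reductionPointCount p) (htam : ¬ p ∣ A.tamagawaProduct)
    (hL : ∃ q : ℚ, q ≠ 0 ∧ A.entireLFunction 1 / (A.realPeriodRat : ℂ) = (q : ℂ) ∧ padicValRat p q = 0)
    (hSel : Nat.card (A.selmerGroupPInfty p) = 1)
    (hC1 : ∃ e : geomTorsion A (p : ℤ) ≃+ geomTorsion W (p : ℤ),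
      ∀ (σ : Field.absoluteGaloisGroup ℚ) (P : geomTorsion A (p : ℤ)), e (σ • P) = σ • e P)
    (κ : ZpExtension ℚ p) (γ : Field.absoluteGaloisGroup ℚ) (hκ : κ.IsCyclotomic)
    (hγ : κ.IsTopGenerator γ) (hγ' : IsCyclotomicVariable p γ)
    [NeZero (W.conductorNorm ℤ)] (f : CuspForm (Gamma0 (W.conductorNorm ℤ)) 2)
    (hf : IsNewformOf W f) (D : W.SelmerDualData κ γ) :
    D.IsTorsion ∧
      ∃ g : IwasawaAlgebra p, D.charIdeal = Ideal.span {g} ∧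
        iwasawaToPowerSeries p g = padicLFunction f (unitRoot W p : ℚ_[p]) := by
  obtain ⟨-, hp, hgood, -, hirr, -⟩ := id hX9
  -- the period unit: `Ω_E = u · Ω⁺_f`, `‖u‖_p = 1`, so `ϖ := u⁻¹` has `ϖ · Ω_E = Ω⁺_f`
  obtain ⟨u, hu, hΩ⟩ := h5 W p hp hgood hirr f hf
  have hu0 : u ≠ 0 := by
    rintro rfl
    simp at hu
  have hϖ : ((u⁻¹ : ℚ) : ℝ) * W.realPeriodRat = plusPeriod f := by
    rw [hΩ, Rat.cast_inv, ← mul_assoc, inv_mul_cancel₀ (by exact_mod_cast hu0), one_mul]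
  obtain ⟨htors, g, hchar, -, hιg⟩ :=
    Literature.NumberTheory.EllipticCurves.Rank1Residual.X9.mazurMainConjecture_of_trivialPartner W A
      p hBCS hGr h5 hGV (classX9_census_of_classX9 W p hX9) hgoodA hordA hna htam hL hSel hC1 κ γ hκ
      hγ hγ' f hf u⁻¹ hϖ D
  -- rescale the generator by the unit `u ∈ ℤ_p^×`
  set c : ℤ_[p] := ⟨(u : ℚ_[p]), hu.le⟩ with hc_def
  have hcu : IsUnit c := PadicInt.isUnit_iff.mpr hu
  refine ⟨htors, PowerSeries.C c * g, ?_, ?_⟩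
  · rw [hchar]
    exact (Ideal.span_singleton_mul_left_unit (hcu.map PowerSeries.C) g).symm
  · have hu0' : (u : ℚ_[p]) ≠ 0 := by exact_mod_cast hu0
    rw [map_mul, hιg, PowerSeries.map_C, ← mul_assoc, ← map_mul, Rat.cast_inv]
    change PowerSeries.C ((u : ℚ_[p]) * (u : ℚ_[p])⁻¹) * _ = _
    rw [mul_inv_cancel₀ hu0', map_one, one_mul]

/-- **`BSD(E,p)` on the certified trivial-partner locus of class X9 (route U2), analytic rank
`≤ 1`** — the typed target `BSDpOnClassX9` delivered pointwise (in Miller's currency `BSDp`), over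
this file's `ClassX9`, for every image type of `ρ̄_{E,p}`. Rank 0 needs the partner certificates
(`hna`, `htam`, `hL`, `hSel`) and C1; rank 1 also the Schneider certificate C3 (`hC3`, asked only
when `r_an = 1`). PUBLISHED binders: BCS 2025 Thm. 1.1.2 (a) (`hBCS`), Greenberg LNM 1716 Thm. 4.1
(`hGr`), the period unit (`h5`), Greenberg–Vatsal 2000 Thm. (1.4) + (1.2) (`hGV`),
Perrin-Riou–Schneider (`hS`), Perrin-Riou 1987 (`hPR`), modularity (`hmodP`, `hmodL`),
Gross–Zagier–Kolyvagin (`hGZK`). Re-export of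
`Rank1Residual.X9.bsdp_of_trivialPartner_of_analyticRank_le_one`.
[cite: GreenbergVatsal2000, Thm. (1.4) (arXiv p. 5)] [cite: GreenbergLNM1716, Thm. 4.1 (p. 102)] [cite: PerrinRiou1987, §1.4 Cor. 1.8] -/
theorem bsdp_of_classX9_of_trivialPartner
    (hBCS : burungale_castella_skinner_charIdeal_eq_padicLFunction)
    (hGr : greenberg_charValue_rankZero) (h5 : realPeriodRat_eq_unit_mul_plusPeriod)
    (hGV : GreenbergVatsal2000.thm14_mainConjecture_transfer_of_torsionIso)
    (hS : Schneider1985_order_charGenerator) (hPR : perrinRiou_rankOne_leadingTerms)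
    (hmodP : nonempty_modularParametrizationData) (hmodL : hasEntireLFunction_rat)
    (hGZK : rank_eq_analyticRank_of_analyticRank_le_one)
    (W A : WeierstrassCurve ℚ) [W.IsElliptic] [W.IsGloballyMinimal] [A.IsElliptic]
    [A.IsGloballyMinimal] (p : ℕ) [Fact p.Prime] (hran : W.analyticRank ≤ 1) (hX9 : ClassX9 W p)
    (hgoodA : A.HasGoodReductionAtPrime p) (hordA : ¬ (p : ℤ) ∣ A.frobeniusTrace p)
    (hna : ¬ p ∣ A.reductionPointCount p) (htam : ¬ p ∣ A.tamagawaProduct)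
    (hL : ∃ q : ℚ, q ≠ 0 ∧ A.entireLFunction 1 / (A.realPeriodRat : ℂ) = (q : ℂ) ∧ padicValRat p q = 0)
    (hSel : Nat.card (A.selmerGroupPInfty p) = 1)
    (hC1 : ∃ e : geomTorsion A (p : ℤ) ≃+ geomTorsion W (p : ℤ),
      ∀ (σ : Field.absoluteGaloisGroup ℚ) (P : geomTorsion A (p : ℤ)), e (σ • P) = σ • e P)
    (hC3 : W.analyticRank = 1 →
      ∀ Dh : PAdicHeightData W p, Dh.IsCanonical → SchneiderConjecture Dh) :
    BSDp W p :=
  Literature.NumberTheory.EllipticCurves.Rank1Residual.X9.bsdp_of_trivialPartner_of_analyticRank_le_one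
    W A p hBCS hGr h5 hGV hS hPR hmodP hmodL hGZK hran (classX9_census_of_classX9 W p hX9) hgoodA
    hordA hna htam hL hSel hC1 hC3

/-- **Route U2 with every binder a PUBLISHED fact or a FINITE certificate** (partner of conductor
`< 5000` and analytic rank `0`; C1 as the Kraus–Oesterlé congruence list). Over this file's
`ClassX9`, analytic rank `≤ 1`. PUBLISHED: Kraus–Oesterlé 1992 Prop. 4 (`hKO`), Miller 2011 /
Creutz–Miller 2012 (`hMiller`), BCS 2025 Thm. 1.1.2 (a) (`hBCS`), Greenberg LNM 1716 Thm. 4.1 (`hGr`),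
the period unit (`h5`), Greenberg–Vatsal 2000 (`hGV`), Perrin-Riou–Schneider (`hS`, `hPR`), modularity
(`hmodP`, `hmodL`), GZK (`hGZK`). FINITE: `r_an(A) = 0` (`hrA`), `N_A < 5000` (`hNA`),
`p ∤ #Ã(𝔽_p)` (`hna`), `p ∤ ∏ c_ℓ(A)` (`htam`), `ord_p(L(A,1)/Ω_A) = 0` (`hL`), the congruences
`hcong`, and C3 in rank 1. Re-export of
`Rank1Residual.X9.bsdp_of_trivialPartner_of_conductor_lt_of_analyticRank_le_one`.
[cite: KrausOesterle1992, Prop. 4] [cite: Miller2011LMS, Thm. 1.2] [cite: CreutzMiller2012, Thm. 1.1] [cite: GreenbergVatsal2000, Thm. (1.4) (arXiv p. 5)] -/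
theorem bsdp_of_classX9_of_trivialPartner_of_conductor_lt
    (hKO : KrausOesterle1992.prop4_torsionIso_of_congruences)
    (hMiller : bsdp_of_irreducible_of_conductor_lt)
    (hBCS : burungale_castella_skinner_charIdeal_eq_padicLFunction)
    (hGr : greenberg_charValue_rankZero) (h5 : realPeriodRat_eq_unit_mul_plusPeriod)
    (hGV : GreenbergVatsal2000.thm14_mainConjecture_transfer_of_torsionIso)
    (hS : Schneider1985_order_charGenerator) (hPR : perrinRiou_rankOne_leadingTerms)
    (hmodP : nonempty_modularParametrizationData) (hmodL : hasEntireLFunction_rat)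
    (hGZK : rank_eq_analyticRank_of_analyticRank_le_one)
    (W A : WeierstrassCurve ℚ) [W.IsElliptic] [W.IsGloballyMinimal] [A.IsElliptic]
    [A.IsGloballyMinimal] (p : ℕ) [Fact p.Prime] (hran : W.analyticRank ≤ 1) (hX9 : ClassX9 W p)
    (hgoodA : A.HasGoodReductionAtPrime p) (hordA : ¬ (p : ℤ) ∣ A.frobeniusTrace p)
    (hrA : A.analyticRank = 0) (hNA : A.conductorNorm ℤ < 5000)
    (hna : ¬ p ∣ A.reductionPointCount p) (htam : ¬ p ∣ A.tamagawaProduct)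
    (hL : ∃ q : ℚ, q ≠ 0 ∧ A.entireLFunction 1 / (A.realPeriodRat : ℂ) = (q : ℂ) ∧ padicValRat p q = 0)
    (hcong : ∀ (ℓ : ℕ) [Fact ℓ.Prime],
      6 * ℓ < KrausOesterle1992.gammaZeroIndex (KrausOesterle1992.modulus W A) →
      (padicValNat ℓ (W.conductorNorm ℤ * A.conductorNorm ℤ) = 0 →
          (p : ℤ) ∣ W.frobeniusTrace ℓ - A.frobeniusTrace ℓ) ∧
        (padicValNat ℓ (W.conductorNorm ℤ * A.conductorNorm ℤ) = 1 →
          (p : ℤ) ∣ W.frobeniusTrace ℓ * A.frobeniusTrace ℓ - (ℓ + 1)))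
    (hC3 : W.analyticRank = 1 →
      ∀ Dh : PAdicHeightData W p, Dh.IsCanonical → SchneiderConjecture Dh) :
    BSDp W p :=
  Literature.NumberTheory.EllipticCurves.Rank1Residual.X9.bsdp_of_trivialPartner_of_conductor_lt_of_analyticRank_le_one
    W A p hKO hMiller hBCS hGr h5 hGV hS hPR hmodP hmodL hGZK hran (classX9_census_of_classX9 W p hX9)
    hgoodA hordA hrA hNA hna htam hL hcong hC3

/-! ### From `X9MuInvariant.lean`: the typed input from `μ = 0`, and the rank-0 equivalence -/

/-- **The typed missing input of class X9 at `(W, p)` from Greenberg's `μ = 0` for `(E, p)` plus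
the analytic certificate.** For `W` globally minimal with `ClassX9 W p`, the cyclotomic data
`(κ, γ)`, the newform `f` of `E` at level `N_E` and a dual datum `D`: if `μ(X(E/ℚ_∞)) = 0`
(`hμ : D.mu = 0`, Greenberg LNM 1716 Conj. 1.11 for this pair — OPEN, an explicit hypothesis, never
asserted) and some coefficient of `L_p(f, α)` is a `p`-adic unit (`hcert`, finite), then `X` is
torsion and `char X = (g)` with `ι g = L_p(f, α)` — the body of `IntegralMainConjectureOnClassX9` at
`(W, p)`. Re-export of `Rank1Residual.mazurMainConjecture_of_mu_eq_zero` (BCS 2025 Thm. 1.1.2 (a)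
`hBCS` + integrality, Greenberg–Vatsal Prop. 3.7, a tree theorem).
[cite: BurungaleCastellaSkinner2025, Thm. 1.1.2 (a) (p. 2 of arXiv:2405.00270v2)] [cite: GreenbergLNM1716, §1 Conj. 1.11] -/
theorem integralMainConjectureOnClassX9_at_of_mu_eq_zero
    (hBCS : burungale_castella_skinner_charIdeal_eq_padicLFunction)
    (W : WeierstrassCurve ℚ) [W.IsElliptic] [W.IsGloballyMinimal] (p : ℕ) [Fact p.Prime]
    (hX9 : ClassX9 W p) (κ : ZpExtension ℚ p) (γ : Field.absoluteGaloisGroup ℚ)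
    (hκ : κ.IsCyclotomic) (hγ : κ.IsTopGenerator γ) (hγ' : IsCyclotomicVariable p γ)
    [NeZero (W.conductorNorm ℤ)] (f : CuspForm (Gamma0 (W.conductorNorm ℤ)) 2)
    (hf : IsNewformOf W f) (D : W.SelmerDualData κ γ) (hμ : D.mu = 0)
    (hcert : ∃ n : ℕ, ‖PowerSeries.coeff n (padicLFunction f (unitRoot W p : ℚ_[p]))‖ = 1) :
    D.IsTorsion ∧
      ∃ g : IwasawaAlgebra p, D.charIdeal = Ideal.span {g} ∧
        iwasawaToPowerSeries p g = padicLFunction f (unitRoot W p : ℚ_[p]) := by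
  obtain ⟨-, hp, hgood, hord, hirr, -⟩ := id hX9
  exact Literature.NumberTheory.EllipticCurves.Rank1Residual.mazurMainConjecture_of_mu_eq_zero hBCS W p
    hp hgood hord hirr κ γ hκ hγ hγ' f hf D hμ hcert

/-- **Class X9, analytic rank 0: the typed target at `(W, p)` is EQUIVALENT to Greenberg's `μ = 0`
for `(E, p)`**, granted one unit coefficient of `𝓛_MSD(E)` (`hcert`) and the PUBLISHED inputs BCS 2025
Thm. 1.1.2 (a) (`hBCS`), Greenberg LNM 1716 Thm. 4.1 (`hGr`), the period unit (`h5`), modularity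
(`hmodP`, `hmodL`) and GZK (`hGZK`). Over THIS file's `ClassX9`, in Miller's currency `BSDp W p`.
Re-export of `Rank1Residual.X9.bsdp_iff_mu_eq_zero`.
[cite: GreenbergLNM1716, §1 Conj. 1.11 and Thm. 4.1 (p. 102)] [cite: CastellaEtAl2021, Thm. 5.1.4 and its proof (§5.1.3)] -/
theorem bsdpOnClassX9_at_iff_mu_eq_zero
    (hBCS : burungale_castella_skinner_charIdeal_eq_padicLFunction)
    (hGr : greenberg_charValue_rankZero) (h5 : realPeriodRat_eq_unit_mul_plusPeriod)
    (hmodP : nonempty_modularParametrizationData) (hmodL : hasEntireLFunction_rat)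
    (hGZK : rank_eq_analyticRank_of_analyticRank_le_one)
    (W : WeierstrassCurve ℚ) [W.IsElliptic] [W.IsGloballyMinimal] (p : ℕ) [Fact p.Prime]
    (hX9 : ClassX9 W p) (hr : W.analyticRank = 0)
    (hcert : ∀ [NeZero (W.conductorNorm ℤ)] (f : CuspForm (Gamma0 (W.conductorNorm ℤ)) 2),
        IsNewformOf W f → ∀ (ϖ : ℚ), (ϖ : ℝ) * W.realPeriodRat = plusPeriod f →
      ∃ n : ℕ, ‖PowerSeries.coeff n
        (PowerSeries.C (ϖ : ℚ_[p]) * padicLFunction f (unitRoot W p : ℚ_[p]))‖ = 1) :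
    BSDp W p ↔
      ∀ (κ : ZpExtension ℚ p) (γ : Field.absoluteGaloisGroup ℚ),
        κ.IsCyclotomic → κ.IsTopGenerator γ → IsCyclotomicVariable p γ →
      ∀ (D : W.SelmerDualData κ γ), D.mu = 0 :=
  Literature.NumberTheory.EllipticCurves.Rank1Residual.X9.bsdp_iff_mu_eq_zero W p hBCS hGr h5 hmodP
    hmodL hGZK (classX9_census_of_classX9 W p hX9) hr hcert

/-- **Route U2′ over this file's `ClassX9`, partner of conductor `< 5000`, analytic rank `≤ 1`: every
binder PUBLISHED or FINITE.** The partner `A` needs only: good ordinary at `p`, `r_an(A) = 0`,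
`N_A < 5000` (so `BSD(A,p)` is Miller / Creutz–Miller, `hMiller`), and ONE unit coefficient of
`𝓛_MSD(A)` (`hcertA`; no triviality of `A`'s arithmetic); C1 is the Kraus–Oesterlé list, C3 in rank 1.
Re-export of `Rank1Residual.X9.bsdp_of_bsdpPartner_of_conductor_lt_of_analyticRank_le_one`.
[cite: Miller2011LMS, Thm. 1.2] [cite: CreutzMiller2012, Thm. 1.1] [cite: KrausOesterle1992, Prop. 4]
[cite: GreenbergVatsal2000, Thm. (1.4) (arXiv p. 5)] -/
theorem bsdp_of_classX9_of_bsdpPartner_of_conductor_lt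
    (hKO : KrausOesterle1992.prop4_torsionIso_of_congruences)
    (hMiller : bsdp_of_irreducible_of_conductor_lt)
    (hBCS : burungale_castella_skinner_charIdeal_eq_padicLFunction)
    (hGr : greenberg_charValue_rankZero) (h5 : realPeriodRat_eq_unit_mul_plusPeriod)
    (hGV : GreenbergVatsal2000.thm14_mainConjecture_transfer_of_torsionIso)
    (hS : Schneider1985_order_charGenerator) (hPR : perrinRiou_rankOne_leadingTerms)
    (hmodP : nonempty_modularParametrizationData) (hmodL : hasEntireLFunction_rat)
    (hGZK : rank_eq_analyticRank_of_analyticRank_le_one)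
    (W A : WeierstrassCurve ℚ) [W.IsElliptic] [W.IsGloballyMinimal] [A.IsElliptic]
    [A.IsGloballyMinimal] (p : ℕ) [Fact p.Prime] (hran : W.analyticRank ≤ 1) (hX9 : ClassX9 W p)
    (hgoodA : A.HasGoodReductionAtPrime p) (hordA : ¬ (p : ℤ) ∣ A.frobeniusTrace p)
    (hrA : A.analyticRank = 0) (hNA : A.conductorNorm ℤ < 5000)
    (hcertA : ∀ [NeZero (A.conductorNorm ℤ)] (fA : CuspForm (Gamma0 (A.conductorNorm ℤ)) 2),
        IsNewformOf A fA → ∀ (ϖ : ℚ), (ϖ : ℝ) * A.realPeriodRat = plusPeriod fA →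
      ∃ n : ℕ, ‖PowerSeries.coeff n
        (PowerSeries.C (ϖ : ℚ_[p]) * padicLFunction fA (unitRoot A p : ℚ_[p]))‖ = 1)
    (hcong : ∀ (ℓ : ℕ) [Fact ℓ.Prime],
      6 * ℓ < KrausOesterle1992.gammaZeroIndex (KrausOesterle1992.modulus W A) →
      (padicValNat ℓ (W.conductorNorm ℤ * A.conductorNorm ℤ) = 0 →
          (p : ℤ) ∣ W.frobeniusTrace ℓ - A.frobeniusTrace ℓ) ∧
        (padicValNat ℓ (W.conductorNorm ℤ * A.conductorNorm ℤ) = 1 →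
          (p : ℤ) ∣ W.frobeniusTrace ℓ * A.frobeniusTrace ℓ - (ℓ + 1)))
    (hC3 : W.analyticRank = 1 →
      ∀ Dh : PAdicHeightData W p, Dh.IsCanonical → SchneiderConjecture Dh) :
    BSDp W p :=
  Literature.NumberTheory.EllipticCurves.Rank1Residual.X9.bsdp_of_bsdpPartner_of_conductor_lt_of_analyticRank_le_one
    W A p hKO hMiller hBCS hGr h5 hGV hS hPR hmodP hmodL hGZK hran (classX9_census_of_classX9 W p hX9)
    hgoodA hordA hrA hNA hcertA hcong hC3

end Summit.BirchSwinnertonDyer.BirchSwinnertonDyer.Rank1Residual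

end
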